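import Summits.CriticalPhenomena.Ising3DConformalLimit.Theorems.MoebiusLimitExists.Negative.MeshContinuity
import Summits.CriticalPhenomena.Ising3DConformalLimit.Theorems.MoebiusLimitExists.Negative.PinnedClusterPoints
import Mathlib.Topology.MetricSpace.Algebra
import Mathlib.Topology.UniformSpace.HeineCantor
import Mathlib.Analysis.Normed.Group.Bounded
import HarnessLib

/-!
# The crux implies BOTH analytic inputs of the compactness schema for the pinned zoom
(crux `MoebiusLimitExists`, item stmt-CriticalPhenomena-1344; refuter `drefute` gen-4, line
`only-interaction-breaks-moebius`)

The lead decomposed the open stub `stub_compactness` as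
`compactnessSchema ∘ ((i) local bounds, (ii) asymptotic equicontinuity) + pinnedZoomTranslationInvariant((ii))`;
the schema, the translation step and (i) GIVEN the two-point law (item stmt-0634) are landed theorems
(`…CompactnessSchema.lean`, `…TranslationInvariant.lean`, `…LocallyBounded.lean`). The only residual
open content of STUB 1 is therefore hypothesis (ii), ASYMPTOTIC EQUICONTINUITY of the pinned zoom on
compact sets of non-coincident configurations along a mesh sequence (for `n = 2` a consequence of
0634; for `n ≥ 4` the open one-step ratio regularity of critical multi-spin correlations on `ℤ³`).

This file certifies, kernel-checked, that (ii) — in the EXACT shape in which `compactnessSchema` and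
`pinnedZoomTranslationInvariant` consume it — and (i) WITHOUT the two-point law both follow from the
crux along EVERY mesh sequence `u k → 0⁺` (no subsequence): `pinnedZoom_asympEquicontinuous_of_crux`,
`pinnedZoom_locallyBounded_of_crux`, packaged as `schemaInputs_of_crux`. Hence a registered
equicontinuity sub-stub of `stub_compactness` is not refutable short of refuting the crux, exactly
like the three open stubs (`OnlyInteractionTightness.openStubs_of_crux`).

Mechanism (folklore): under a limit witness `(ρ, S')` the pinned zoom along any `v k → 0⁺` inside
`(0,1]` converges locally uniformly to `aⁿ S'ₙ` (exact factorisation `ρ_pin = r(δ)^{-1/2}ρ`,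
`PinnedClusterPoints.rescaled_pin_eq`; the argument of
`OnlyInteractionTightness.tendstoLocallyUniformlyOn_rescaled_pin`, inlined); a general
`u k → 0⁺` is clamped into `(0,1]` (equal eventually, `TendstoLocallyUniformlyOn.congr_inseparable`);
the limit is continuous on `NonCoincident` (mesh continuity, `continuousOn_limit`); and locally uniform
convergence on an open set to a continuous limit is uniformly Cauchy-free equicontinuity on compacts by
the `ε/3` argument (Heine–Cantor on the compact, `Metric.tendstoUniformlyOn_iff`), resp. eventual
uniform boundedness by `IsCompact.exists_bound_of_continuousOn`.
-/

noncomputable section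

open Filter Topology Set Function
open Literature.Probability.LatticeModels
open Summit.CriticalPhenomena.Ising3DConformalLimit.MoebiusLimitExistsOnlyInteraction
open Summit.CriticalPhenomena.Ising3DConformalLimit.PinnedClusterPoints
open Summit.CriticalPhenomena.Ising3DConformalLimit.LimitMeshContinuity

namespace Summit.CriticalPhenomena.Ising3DConformalLimit.AsympEquicontinuityTight

/-! ## Two abstract `ε/3` lemmas -/

/-- **Locally uniform convergence to a continuous limit is asymptotically equicontinuous on compacts**:
if `F k → f` locally uniformly on `s`, `f` is continuous on `s` and `K ⊆ s` is compact, then for every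
`ε > 0` there is `η > 0` with `|F k x − F k y| < ε` for all `x, y ∈ K`, `dist x y < η`, for all large
`k` (`ε/3`: uniform convergence on `K` + Heine–Cantor for `f` on `K`). [folklore] -/
theorem asympEquicontinuousOn_of_tendstoLocallyUniformlyOn {X : Type*} [PseudoMetricSpace X]
    {F : ℕ → X → ℝ} {f : X → ℝ} {s K : Set X}
    (h : TendstoLocallyUniformlyOn F f atTop s) (hf : ContinuousOn f s)
    (hK : IsCompact K) (hKs : K ⊆ s) :
    ∀ ε > 0, ∃ η > 0, ∀ᶠ k in atTop, ∀ x ∈ K, ∀ y ∈ K, dist x y < η → |F k x - F k y| < ε := by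
  intro ε hε
  have hε3 : 0 < ε / 3 := by positivity
  have hU : TendstoUniformlyOn F f atTop K :=
    (tendstoLocallyUniformlyOn_iff_tendstoUniformlyOn_of_compact hK).1 (h.mono hKs)
  have hUC : UniformContinuousOn f K := hK.uniformContinuousOn_of_continuous (hf.mono hKs)
  obtain ⟨η, hη, hηf⟩ := Metric.uniformContinuousOn_iff.1 hUC (ε / 3) hε3
  refine ⟨η, hη, ?_⟩
  filter_upwards [Metric.tendstoUniformlyOn_iff.1 hU (ε / 3) hε3] with k hk
  intro x hx y hy hxy
  have h1 : dist (F k x) (f x) < ε / 3 := by rw [dist_comm]; exact hk x hx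
  have h2 : dist (f x) (f y) < ε / 3 := hηf x hx y hy hxy
  have h3 : dist (f y) (F k y) < ε / 3 := hk y hy
  rw [← Real.dist_eq]
  calc dist (F k x) (F k y) ≤ dist (F k x) (f x) + dist (f x) (f y) + dist (f y) (F k y) :=
        dist_triangle4 _ _ _ _
    _ < ε / 3 + ε / 3 + ε / 3 := add_lt_add (add_lt_add h1 h2) h3
    _ = ε := by ring

/-- **Locally uniform convergence to a continuous limit is eventually uniformly bounded on compacts.**
[folklore] -/
theorem eventually_abs_le_of_tendstoLocallyUniformlyOn {X : Type*} [PseudoMetricSpace X]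
    {F : ℕ → X → ℝ} {f : X → ℝ} {s K : Set X}
    (h : TendstoLocallyUniformlyOn F f atTop s) (hf : ContinuousOn f s)
    (hK : IsCompact K) (hKs : K ⊆ s) :
    ∃ B : ℝ, ∀ᶠ k in atTop, ∀ x ∈ K, |F k x| ≤ B := by
  have hU : TendstoUniformlyOn F f atTop K :=
    (tendstoLocallyUniformlyOn_iff_tendstoUniformlyOn_of_compact hK).1 (h.mono hKs)
  obtain ⟨C, hC⟩ := hK.exists_bound_of_continuousOn (hf.mono hKs)
  refine ⟨C + 1, ?_⟩
  filter_upwards [Metric.tendstoUniformlyOn_iff.1 hU 1 one_pos] with k hk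
  intro x hx
  have h1 : dist (f x) (F k x) < 1 := hk x hx
  have h2 : ‖f x‖ ≤ C := hC x hx
  rw [Real.dist_eq] at h1
  rw [Real.norm_eq_abs] at h2
  have h3 := abs_sub_abs_le_abs_sub (F k x) (f x)
  rw [abs_sub_comm] at h3
  linarith

/-! ## The pinned zoom under the crux: convergence along EVERY mesh sequence -/

open Classical in
/-- **Under the crux the pinned zoom converges along every mesh sequence `u k → 0⁺`** (no
subsequence, no restriction to `(0,1]`), locally uniformly off the diagonals and for every `n`, to a
family continuous on `NonCoincident` (namely `aⁿ S'ₙ` for any limit witness `(ρ, S')`,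
`a = S'₂(0,e₀)^{-1/2}`). The finitely many `u k ∉ (0,1]` are clamped to `1`. [folklore] -/
theorem pinnedZoom_tendsto_of_crux
    (h : Summit.CriticalPhenomena.Ising3DConformalLimit.Theses.EnergyNotSigmaSquared.MoebiusLimit) :
    ∀ u : ℕ → ℝ, Tendsto u atTop (𝓝[>] (0 : ℝ)) →
      ∃ T : CorrFamily 3, (∀ n, ContinuousOn (T n) (NonCoincident 3 n)) ∧
        ∀ n, TendstoLocallyUniformlyOn (fun k => rescaledCorrelator (criticalCorr 3) rhoPin n (u k))
          (T n) atTop (NonCoincident 3 n) := by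
  obtain ⟨ρ, Δ', S', hρ, -, hlim, hnd, -⟩ := h
  intro u hu
  set a : ℝ := (S' 2 (![0, EuclideanSpace.single 0 1] : Fin 2 → EuclideanSpace ℝ (Fin 3))) ^ (-(1 / 2 : ℝ))
    with ha
  -- clamp `u` into `(0,1]`
  set v : ℕ → ℝ := fun k => if u k ∈ Set.Ioc (0:ℝ) 1 then u k else 1 with hv_def
  have hv1 : ∀ k, v k ∈ Set.Ioc (0:ℝ) 1 := by
    intro k
    by_cases hk : u k ∈ Set.Ioc (0:ℝ) 1
    · simp only [hv_def, if_pos hk]; exact hk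
    · simp only [hv_def, if_neg hk]; exact ⟨one_pos, le_rfl⟩
  have huv : ∀ᶠ k in atTop, v k = u k := by
    filter_upwards [hu.eventually (Ioc_mem_nhdsGT one_pos)] with k hk
    have hk' : u k ∈ Set.Ioc (0:ℝ) 1 := hk
    simp only [hv_def, if_pos hk']
  have hv : Tendsto v atTop (𝓝[>] (0:ℝ)) := hu.congr' (huv.mono fun k hk => hk.symm)
  refine ⟨fun n x => a ^ n * S' n x, fun n => continuousOn_const.mul (continuousOn_limit hlim n),
    fun n => ?_⟩
  -- locally uniform convergence along `v` (inside `(0,1]`): exact factorisation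
  -- `ρ_pinⁿ⟨…⟩ = r(δ)^{-n/2} · ρⁿ⟨…⟩` (`rescaled_pin_eq`), convergent scalar factor, locally bounded
  -- continuous limit (mesh continuity); cf. `OnlyInteractionTightness.tendstoLocallyUniformlyOn_rescaled_pin`.
  have hA : 0 < S' 2 (![0, EuclideanSpace.single 0 1] : Fin 2 → EuclideanSpace ℝ (Fin 3)) :=
    hnd _ cfg01_mem
  have hT : TendstoLocallyUniformlyOn (fun k => rescaledCorrelator (criticalCorr 3) rhoPin n (v k))
      (fun x => a ^ n * S' n x) atTop (NonCoincident 3 n) := by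
    set r : ℕ → ℝ := fun k => (rescaledCorrelator (criticalCorr 3) ρ 2 (v k)
      (![0, EuclideanSpace.single 0 1] : Fin 2 → EuclideanSpace ℝ (Fin 3))) ^ (-(1 / 2 : ℝ)) with hr
    have hr_t : Tendsto (fun k => r k ^ n) atTop (𝓝 (a ^ n)) := by
      have h2 : Tendsto (fun k => rescaledCorrelator (criticalCorr 3) ρ 2 (v k)
          (![0, EuclideanSpace.single 0 1] : Fin 2 → EuclideanSpace ℝ (Fin 3))) atTop
          (𝓝 (S' 2 (![0, EuclideanSpace.single 0 1] : Fin 2 → EuclideanSpace ℝ (Fin 3)))) :=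
        ((hlim 2).tendsto_at cfg01_mem).comp hv
      exact (h2.rpow_const (p := -(1 / 2 : ℝ)) (Or.inl hA.ne')).pow n
    have hF1 : TendstoLocallyUniformlyOn (fun k (_ : Fin n → EuclideanSpace ℝ (Fin 3)) => r k ^ n)
        (fun _ => a ^ n) atTop (NonCoincident 3 n) :=
      (hr_t.tendstoUniformlyOn_const (NonCoincident 3 n)).tendstoLocallyUniformlyOn
    have hF2 : TendstoLocallyUniformlyOn (fun k => rescaledCorrelator (criticalCorr 3) ρ n (v k))
        (S' n) atTop (NonCoincident 3 n) := by
      intro U hU x hx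
      obtain ⟨t, ht, hev⟩ := hlim n U hU x hx
      exact ⟨t, ht, hv.eventually hev⟩
    have hprod := hF1.mul₀_of_isBoundedUnder hF2
      (fun x _ => isBoundedUnder_of ⟨dist (a ^ n) 0, fun _ => le_rfl⟩)
      (fun x hx => (((continuousOn_limit hlim n) x hx).dist tendsto_const_nhds).isBoundedUnder_le)
    have heq : (fun k => rescaledCorrelator (criticalCorr 3) rhoPin n (v k)) =
        (fun k (_ : Fin n → EuclideanSpace ℝ (Fin 3)) => r k ^ n) *
          (fun k => rescaledCorrelator (criticalCorr 3) ρ n (v k)) := by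
      funext k x
      exact rescaled_pin_eq (hρ _ (hv1 k)) n x
    rw [heq]
    exact hprod
  refine hT.congr_inseparable ?_
  filter_upwards [huv] with k hk
  intro x _
  exact .of_eq (by rw [hk])

/-! ## The two schema inputs from the crux -/

/-- **crux ⇒ (ii) ASYMPTOTIC EQUICONTINUITY of the pinned zoom** — the second hypothesis of
`compactnessSchema` (instantiated at the pinned zoom) and of `pinnedZoomTranslationInvariant`,
verbatim shape, along every mesh sequence. So an equicontinuity sub-stub of `stub_compactness` is
crux-implied: not refutable short of refuting `MoebiusLimitExists`. [folklore] -/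
theorem pinnedZoom_asympEquicontinuous_of_crux
    (h : Summit.CriticalPhenomena.Ising3DConformalLimit.Theses.EnergyNotSigmaSquared.MoebiusLimit) :
    ∀ u : ℕ → ℝ, Tendsto u atTop (𝓝[>] (0 : ℝ)) →
      ∀ n (K : Set (Fin n → EuclideanSpace ℝ (Fin 3))), IsCompact K → K ⊆ NonCoincident 3 n →
        ∀ ε > 0, ∃ η > 0, ∀ᶠ k in atTop, ∀ x ∈ K, ∀ y ∈ K, dist x y < η →
          |rescaledCorrelator (criticalCorr 3) rhoPin n (u k) x -
            rescaledCorrelator (criticalCorr 3) rhoPin n (u k) y| < ε := by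
  intro u hu n K hK hKs
  obtain ⟨T, hT, hconv⟩ := pinnedZoom_tendsto_of_crux h u hu
  exact asympEquicontinuousOn_of_tendstoLocallyUniformlyOn (hconv n) (hT n) hK hKs

/-- **crux ⇒ (i) LOCAL BOUNDS of the pinned zoom WITHOUT the two-point law** — the first hypothesis of
`compactnessSchema` (instantiated at the pinned zoom), along every mesh sequence; the landed
`pinnedZoomLocallyBounded` needs item stmt-0634 only because it runs BEFORE the limit exists.
[folklore] -/
theorem pinnedZoom_locallyBounded_of_crux
    (h : Summit.CriticalPhenomena.Ising3DConformalLimit.Theses.EnergyNotSigmaSquared.MoebiusLimit) :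
    ∀ u : ℕ → ℝ, Tendsto u atTop (𝓝[>] (0 : ℝ)) →
      ∀ n (K : Set (Fin n → EuclideanSpace ℝ (Fin 3))), IsCompact K → K ⊆ NonCoincident 3 n →
        ∃ B : ℝ, ∀ᶠ k in atTop, ∀ x ∈ K, |rescaledCorrelator (criticalCorr 3) rhoPin n (u k) x| ≤ B := by
  intro u hu n K hK hKs
  obtain ⟨T, hT, hconv⟩ := pinnedZoom_tendsto_of_crux h u hu
  exact eventually_abs_le_of_tendstoLocallyUniformlyOn (hconv n) (hT n) hK hKs

/-- **CERTIFICATE: the crux implies both analytic inputs (i), (ii) of the lead's decomposition of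
`stub_compactness`** along every mesh sequence. Composed with the landed `compactnessSchema` and
`pinnedZoomTranslationInvariant` this re-derives `stub1_of_crux`; read contrapositively, the only way
to refute the residual equicontinuity sub-goal of STUB 1 is to refute the crux. [folklore] -/
theorem schemaInputs_of_crux
    (h : Summit.CriticalPhenomena.Ising3DConformalLimit.Theses.EnergyNotSigmaSquared.MoebiusLimit) :
    (∀ u : ℕ → ℝ, Tendsto u atTop (𝓝[>] (0 : ℝ)) →
      ∀ n (K : Set (Fin n → EuclideanSpace ℝ (Fin 3))), IsCompact K → K ⊆ NonCoincident 3 n →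
        ∃ B : ℝ, ∀ᶠ k in atTop, ∀ x ∈ K, |rescaledCorrelator (criticalCorr 3) rhoPin n (u k) x| ≤ B) ∧
    (∀ u : ℕ → ℝ, Tendsto u atTop (𝓝[>] (0 : ℝ)) →
      ∀ n (K : Set (Fin n → EuclideanSpace ℝ (Fin 3))), IsCompact K → K ⊆ NonCoincident 3 n →
        ∀ ε > 0, ∃ η > 0, ∀ᶠ k in atTop, ∀ x ∈ K, ∀ y ∈ K, dist x y < η →
          |rescaledCorrelator (criticalCorr 3) rhoPin n (u k) x -
            rescaledCorrelator (criticalCorr 3) rhoPin n (u k) y| < ε) :=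
  ⟨pinnedZoom_locallyBounded_of_crux h, pinnedZoom_asympEquicontinuous_of_crux h⟩

end Summit.CriticalPhenomena.Ising3DConformalLimit.AsympEquicontinuityTight

end
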